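import Literature.Computability.AlgebraicComplexity.GlobalStageCellData
import Literature.Computability.AlgebraicComplexity.ShannonEntropyModulus
import HarnessLib

/-!
# VXXZ Theorem 5.3, one region: `2^{o(n)}` copies of `(CW_q^{⊗c})^{⊗n}` degenerate to
`2^{(E₁ − o_ε(1)) n − o(n)}` copies of the level-`ℓ` `ε`-interface tensor — proved, explicit errors

Topic `Literature/Computability/AlgebraicComplexity`.  Theorem 5.3 of Vassilevska Williams–Xu–Xu–Zhou,
*New bounds for matrix multiplication: from alpha to omega* (SODA 2024, arXiv:2307.07970, §5, p. 18–19),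
for the first region (the three-region product is bookkeeping with `GlobalStageRegions.lean` and
`InterfaceSlotSymmetry.lean`): from `2^{o(n)}` independent copies of `(CW_q^{⊗2^{ℓ−1}})^{⊗n}` one
obtains `2^{(E₁ − o_{1/ε}(1))n − o(n)}` independent copies of the level-`ℓ` `ε`-interface tensor with
parameter list `{(n α(i,j,k), i, j, k, γ_{X,i,j,k}, γ_{Y,i,j,k}, γ_{Z,i,j,k})}_{i+j+k=2^ℓ}`,
`E₁ = min{H(α_X) − P_α, H(α_Y) − P_α, H(γ̄_Z) − λ_Z}`.  Here everything is at a FIXED `n`, at the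
type point `α = Q/n`, with every lower-order term explicit; the proof is the printed one:

1. (`GlobalStageCellData.lean`) one copy of the input per realised cell `ξ` of `𝒯_{τ₀,L(γ),ε}` — at
   most `((n+1)^{3^c|S₃|})^3 = 2^{o(n)}` cells — is degenerated by Prop. 5.1 into `κ_ξ` copies of the
   exact interface tensor of the cell, `log₂(κ_ξ+1) ≥ n E₁'(ξ) − thm53Err` (`vxxz2024_thm53_cell`);
2. (this file, continuity) **`E₁'(ξ) ≥ E₁ − epsLoss(ε)`**: the realised `θ/n` (joint type of
   `(K₀, ẑ)`) is within `ε` of `θ̄ = γ̄_Z` (`abs_pairDist_sub_targetPairDist_le`) and `ẑ` is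
   `ε`-admissible for the coarse datum of Def. 5.15 (`mem_levelBlocksX_coarse_of_mem_levelBlocksZ`:
   averaging over `S_{+,+,k}` keeps `ε`-consistency, `splitConsistentOn_posClassPP`), so by the
   entropy modulus (`ShannonEntropyModulus.lean`) `H(θ/n) ≥ H(γ̄_Z) − |A_pair| m(ε)` and
   `Λ/n ≤ λ_Z + 3^c m(ε)` (`shannonEntropy_targetPairDist_sub_le`, `realisedLambda_le_targetLambda_add`);
3. (this file, merge) with the uniform `κ = ⌈2^{bound}⌉ − 1 ≤ κ_ξ`:
   `⟨#cells⟩ ⊗ input ≥ ⊕_ξ input ≥ ⊕_ξ ⟨κ⟩ ⊗ 𝒯_ξ ≥ ⟨κ⟩ ⊗ ⊕_ξ 𝒯_ξ ≥ ⟨κ⟩ ⊗ 𝒯_{τ₀,L(γ),ε}`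
   (`familyDirectSum_kronecker_unit_le`, `vxxz2024_thm53_merge`).

Main statement: `vxxz2024_thm53_region`.  Definitions: `targetPairDist` (`γ̄_Z` as a distribution on
pairs (level, shape)), `targetLambda` (`λ_Z`), `epsLoss` (the explicit `o_{1/ε}(1)`, `→ 0` as `ε → 0`,
`tendsto_epsLoss`).  Everything is proved; no named facts.

## References

* V. Vassilevska Williams, Y. Xu, Z. Xu, R. Zhou, *New bounds for matrix multiplication: from alpha
  to omega*, SODA 2024, arXiv:2307.07970 (held: `paper:arxiv-2307.07970`), Thm. 5.3 and its proof
  (p. 19), Prop. 5.1, Def. 5.15. [VassilevskaWilliamsXuXuZhou2024]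
-/

noncomputable section

open scoped BigOperators
open Finset

namespace Literature.Computability.AlgebraicComplexity

open Literature.Barriers.MatrixMultiplication (bigCwTensor)

universe u

/-! ## Tensor algebra: copies commute with direct sums -/

section Algebra

variable {K : Type u} [CommSemiring K] {J X Y Z : Type*} [Fintype J] [Fintype X] [Fintype Y] [Fintype Z]

/-- **`⊕_j (⟨m⟩ ⊗ S_j) ≥ ⟨m⟩ ⊗ ⊕_j S_j`** (indeed an isomorphism: reorder the indices).
[cite: VassilevskaWilliamsXuXuZhou2024, Thm. 5.3 (proof: "independent copies of a direct sum")] -/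
theorem familyDirectSum_kronecker_unit_le [DecidableEq J] (m : ℕ) (S : J → X → Y → Z → K) :
    TensorRestrictsTo (familyDirectSum fun j => kroneckerTensor (unitTensor K m) (S j))
      (kroneckerTensor (unitTensor K m) (familyDirectSum S)) := by
  have key : kroneckerTensor (unitTensor K m) (familyDirectSum S) = fun a b c =>
      (familyDirectSum fun j => kroneckerTensor (unitTensor K m) (S j)) (a.2.1, (a.1, a.2.2))
        (b.2.1, (b.1, b.2.2)) (c.2.1, (c.1, c.2.2)) := by
    funext a b c
    simp only [kroneckerTensor_apply, familyDirectSum_apply, mul_ite, mul_zero]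
  rw [key]
  exact TensorRestrictsTo.comap _ _ _ _

/-- **`⟨N⟩ ⊗ P ≥ ⊕_{j ∈ J} P` for `|J| ≤ N`** (a constant family of copies). [folklore] -/
theorem kronecker_unit_le_familyDirectSum_const [DecidableEq J] [DecidableEq X] [DecidableEq Y] [DecidableEq Z]
    {N : ℕ} (hJ : Fintype.card J ≤ N) (P : X → Y → Z → K) :
    TensorRestrictsTo (kroneckerTensor (unitTensor K N) P) (familyDirectSum fun _ : J => P) := by
  have h1 : TensorRestrictsTo (kroneckerTensor (unitTensor K N) P)
      (kroneckerTensor (unitTensor K (Fintype.card J)) P) :=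
    TensorRestrictsTo.kronecker (tensorRestrictsTo_unitTensor_castLE hJ) (TensorRestrictsTo.refl P)
  rw [← familyDirectSum_const (Fintype.card J) P] at h1
  exact h1.trans (familyDirectSum_reindex (fun _ : Fin (Fintype.card J) => P) (Fintype.equivFin J).injective)

end Algebra

/-! ## `ε`-admissibility passes to the coarse datum (Def. 5.15 up to `ε`) -/

section CoarseEps

variable {c n : ℕ}

/-- An `ε`-admissible `Z`-sequence of `𝒯_{τ₀,L(γ),ε}` is `ε`-consistent with `γ_{Z,i,j,k}` on every
occurring class `S_{i,j,k}`. [cite: VassilevskaWilliamsXuXuZhou2024, Def. 3.6 and Def. 4.1] -/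
theorem splitConsistentOn_posClass_of_mem_levelBlocksZ {I J K : Fin n → ℕ} (h : IsLevelTriple c I J K)
    {γX γY γZ : ℕ × ℕ × ℕ → (Fin c → Fin 3) → ℝ} {ε : ℝ} {Kh : Fin n → Fin c → Fin 3}
    (hK : Kh ∈ levelBlocksZ (tripleTermMap h) (tripleTermList c γX γY γZ) ε) (i j k : ℕ)
    (hne : (posClass I J K i j k).Nonempty) : SplitConsistentOn ε (γZ (i, j, k)) Kh (posClass I J K i j k) := by
  by_cases hijk : i + j + k = 2 * c
  · set s := (constituentTriples c).equivFin ⟨(i, j, k), (mem_constituentTriples c).2 hijk⟩ with hs_def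
    have hs : (univ.filter fun t => tripleTermMap h t = s) = posClass I J K i j k := by
      rw [filter_tripleTermMap_eq h s]; simp [s]
    have := (mem_admissibleSeqs.1 hK).2 s (by rw [hs]; exact hne)
    rw [hs] at this
    simpa [tripleTermList, s] using this
  · exfalso
    rw [posClass_eq_empty h hijk] at hne
    exact Finset.not_nonempty_empty hne

/-- **Averaging preserves `ε`-consistency**: if `K̂` is `ε`-consistent with `γ_{Z,i,j,k}` on every
occurring class `S_{i,j,k}` with `i, j > 0` of an `α`-consistent triple, then on `S_{+,+,k}` it is
`ε`-consistent with `γ̄_{Z,+,+,k} = ∑ α(i,j,k) γ_{Z,i,j,k} / α(+,+,k)` (the split distribution on a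
union is the size-weighted average). [cite: VassilevskaWilliamsXuXuZhou2024, Def. 5.15 (discussion) and Thm. 5.3 (proof, continuity)] -/
theorem splitConsistentOn_posClassPP {α : ℕ × ℕ × ℕ → ℝ} {γZ : ℕ × ℕ × ℕ → (Fin c → Fin 3) → ℝ}
    {I J K : Fin n → ℕ} (h : IsLevelTriple c I J K) (hα : IsAlphaConsistent α I J K) {Kh : Fin n → Fin c → Fin 3}
    {ε : ℝ} (k : ℕ)
    (hfine : ∀ i, (posClass I J K i (2 * c - k - i) k).Nonempty →
      SplitConsistentOn ε (γZ (i, 2 * c - k - i, k)) Kh (posClass I J K i (2 * c - k - i) k))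
    (hne : (posClassPP I J K k).Nonempty) : SplitConsistentOn ε (gammaBarZPP c α γZ k) Kh (posClassPP I J K k) := by
  intro σ
  set F := (range (2 * c + 1)).filter (fun i => ¬ (i = 0 ∨ 2 * c - k - i = 0)) with hF
  set PP := posClassPP I J K k with hPP
  have hPPpos : (0 : ℝ) < PP.card := by exact_mod_cast hne.card_pos
  have hn : (n : ℝ) ≠ 0 := by
    obtain ⟨t, _⟩ := hne
    have : 0 < n := Fin.pos t
    exact_mod_cast this.ne'
  -- sizes
  have hcard : (PP.card : ℝ) = ∑ i ∈ F, ((posClass I J K i (2 * c - k - i) k).card : ℝ) := by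
    have := card_filter_posClassPP_eq_sum h k (fun _ => True)
    simp only [Finset.filter_true_of_mem (fun _ _ => trivial)] at this
    rw [hPP, this]; push_cast; rfl
  have hcardPP : (PP.card : ℝ) = alphaPP c α k * n := card_posClassPP_eq h hα k
  have hαPP : alphaPP c α k ≠ 0 := by
    intro h0; rw [h0, zero_mul] at hcardPP; exact hPPpos.ne' hcardPP
  -- numerator of the split distribution on `S_{+,+,k}`
  have hnum : completeSplitOn Kh PP σ * PP.card =
      ∑ i ∈ F, completeSplitOn Kh (posClass I J K i (2 * c - k - i) k) σ * (posClass I J K i (2 * c - k - i) k).card := by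
    rw [completeSplitOn_mul_card, hPP, card_filter_posClassPP_eq_sum h k]
    push_cast
    exact sum_congr rfl fun i _ => (completeSplitOn_mul_card Kh _ σ).symm
  -- the average `γ̄` times `|S_{+,+,k}|`
  have hbar : gammaBarZPP c α γZ k σ * PP.card =
      ∑ i ∈ F, (posClass I J K i (2 * c - k - i) k).card * γZ (i, 2 * c - k - i, k) σ := by
    have e1 : gammaBarZPP c α γZ k σ * alphaPP c α k =
        ∑ i ∈ F, α (i, 2 * c - k - i, k) * γZ (i, 2 * c - k - i, k) σ := by
      simp only [gammaBarZPP]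
      rw [div_mul_cancel₀ _ hαPP]
    rw [hcardPP, ← mul_assoc, e1, sum_mul]
    refine sum_congr rfl fun i _ => ?_
    rw [hα]; ring
  -- the difference
  have hdiff : (completeSplitOn Kh PP σ - gammaBarZPP c α γZ k σ) * PP.card =
      ∑ i ∈ F, ((posClass I J K i (2 * c - k - i) k).card : ℝ) *
        (completeSplitOn Kh (posClass I J K i (2 * c - k - i) k) σ - γZ (i, 2 * c - k - i, k) σ) := by
    rw [sub_mul, hnum, hbar, ← sum_sub_distrib]
    refine sum_congr rfl fun i _ => ?_; ring
  have habs : |completeSplitOn Kh PP σ - gammaBarZPP c α γZ k σ| * PP.card ≤ ε * PP.card := by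
    rw [← abs_of_pos hPPpos, ← abs_mul, hdiff, abs_of_pos hPPpos, hcard, mul_sum]
    refine (abs_sum_le_sum_abs _ _).trans (sum_le_sum fun i _ => ?_)
    rcases (posClass I J K i (2 * c - k - i) k).eq_empty_or_nonempty with h0 | hne'
    · rw [h0, card_empty, Nat.cast_zero, zero_mul, abs_zero, mul_zero]
    · rw [abs_mul, abs_of_nonneg (Nat.cast_nonneg _), mul_comm]
      exact mul_le_mul_of_nonneg_right (hfine i hne' σ) (Nat.cast_nonneg _)
  exact le_of_mul_le_mul_right habs hPPpos

/-- **An `ε`-admissible `Z`-sequence of `𝒯_{τ₀,L(γ),ε}` is `ε`-admissible for the coarse datum**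
(`ε`-consistent with `γ_{Z,i,j,k}` on the boundary classes and with `γ̄_{Z,+,+,k}` on `S_{+,+,k}`;
`ε = 0` is one half of `mem_levelBlocksX_coarse_iff`). [cite: VassilevskaWilliamsXuXuZhou2024, Def. 5.15 and Thm. 5.3 (proof)] -/
theorem mem_levelBlocksX_coarse_of_mem_levelBlocksZ {α : ℕ × ℕ × ℕ → ℝ} {γX γY γZ : ℕ × ℕ × ℕ → (Fin c → Fin 3) → ℝ}
    {I J K : Fin n → ℕ} (h : IsLevelTriple c I J K) (hα : IsAlphaConsistent α I J K) {Kh : Fin n → Fin c → Fin 3}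
    {ε : ℝ} (hK : Kh ∈ levelBlocksZ (tripleTermMap h) (tripleTermList c γX γY γZ) ε) :
    Kh ∈ levelBlocksX (coarseTermMap h) (coarseTermList c α γZ) ε := by
  have hlevK : chunkLevels Kh = K := chunkLevels_eq_of_mem_levelBlocksZ_triple h hK
  rw [levelBlocksX, mem_admissibleSeqs]
  refine ⟨fun t => ?_, fun s hne => ?_⟩
  · simp only [coarseTermList, coarseTermMap, Equiv.symm_apply_apply]
    have : (coarseClassOf I J K t).2 = K t := by
      unfold coarseClassOf; split_ifs <;> rfl
    rw [this, ← hlevK, chunkLevels_apply]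
  · rw [filter_coarseTermMap_eq] at hne ⊢
    simp only [coarseTermList]
    generalize hcs : (coarseClasses c).equivFin.symm s = cs at hne ⊢
    obtain ⟨cl, hcl⟩ := cs
    rcases cl with ⟨_ | ⟨i, j⟩, k⟩
    · rw [filter_coarseClassOf_none] at hne ⊢
      simp only [coarseGamma]
      exact splitConsistentOn_posClassPP h hα k
        (fun i hne' => splitConsistentOn_posClass_of_mem_levelBlocksZ h hK _ _ _ hne') hne
    · have hb : i = 0 ∨ j = 0 := by
        rcases mem_union.1 hcl with hcl | hcl
        · obtain ⟨ijk, hijk, he⟩ := mem_image.1 hcl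
          simp only [Prod.mk.injEq, Option.some.injEq] at he
          obtain ⟨⟨rfl, rfl⟩, -⟩ := he
          exact (mem_filter.1 hijk).2
        · obtain ⟨k', -, he⟩ := mem_image.1 hcl
          simp at he
      rw [filter_coarseClassOf_some hb] at hne ⊢
      simp only [coarseGamma]
      exact splitConsistentOn_posClass_of_mem_levelBlocksZ h hK i j k hne

/-- The coarse split distributions lie in `[0, 1]` when the `γ_Z` do and `α ≥ 0`. [cite: VassilevskaWilliamsXuXuZhou2024, §5 (γ̄_{Z,+,+,k})] -/
theorem coarseGamma_mem_Icc {α : ℕ × ℕ × ℕ → ℝ} {γZ : ℕ × ℕ × ℕ → (Fin c → Fin 3) → ℝ}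
    (hα0 : ∀ ijk, 0 ≤ α ijk) (hγ0 : ∀ ijk σ, 0 ≤ γZ ijk σ) (hγ1 : ∀ ijk σ, γZ ijk σ ≤ 1)
    (cl : Option (ℕ × ℕ) × ℕ) (σ : Fin c → Fin 3) : 0 ≤ coarseGamma c α γZ cl σ ∧ coarseGamma c α γZ cl σ ≤ 1 := by
  rcases cl with ⟨_ | ⟨i, j⟩, k⟩
  · simp only [coarseGamma, gammaBarZPP, alphaPP]
    set F := (range (2 * c + 1)).filter (fun i => ¬ (i = 0 ∨ 2 * c - k - i = 0))
    have hden : 0 ≤ ∑ i ∈ F, α (i, 2 * c - k - i, k) := sum_nonneg fun i _ => hα0 _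
    have hnum0 : 0 ≤ ∑ i ∈ F, α (i, 2 * c - k - i, k) * γZ (i, 2 * c - k - i, k) σ :=
      sum_nonneg fun i _ => mul_nonneg (hα0 _) (hγ0 _ _)
    have hnum1 : ∑ i ∈ F, α (i, 2 * c - k - i, k) * γZ (i, 2 * c - k - i, k) σ ≤ ∑ i ∈ F, α (i, 2 * c - k - i, k) :=
      sum_le_sum fun i _ => by nlinarith [hα0 (i, 2 * c - k - i, k), hγ1 (i, 2 * c - k - i, k) σ]
    refine ⟨div_nonneg hnum0 hden, ?_⟩
    rcases hden.eq_or_lt with h0 | hpos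
    · rw [← h0, div_zero]; exact zero_le_one
    · rw [div_le_one hpos]; exact hnum1
  · simp only [coarseGamma]
    exact ⟨hγ0 _ _, hγ1 _ _⟩

end CoarseEps

/-! ## The target exponent of region 1 at the type `Q/n`: `H(γ̄_Z)` and `λ_Z` -/

section Target

variable {c n : ℕ}

/-- **`γ̄_Z` as a distribution on pairs (level, chunk shape)**: `θ̄(k', σ) = ∑_{t : k_t = k'} (n_t/n) γ_Z^{(t)}(σ)`
over the terms `t = (i_t, j_t, k_t)` of `𝒯*_{T₀}` (`n_t = |S_{i,j,k}| = α(i,j,k) n`).  Its Shannon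
entropy is `H(γ̄_Z)`, `γ̄_Z = ∑ α(i,j,k) γ_{Z,i,j,k}`, for split distributions supported on shapes of
the right level (the map `σ ↦ (level σ, σ)` is injective). [cite: VassilevskaWilliamsXuXuZhou2024, §5 (preamble: γ̄_Z) and Claim 5.14 (proof, (2))] -/
def targetPairDist {I J K : Fin n → ℕ} (h : IsLevelTriple c I J K) (γZ : ℕ × ℕ × ℕ → (Fin c → Fin 3) → ℝ) :
    Fin (2 * c + 1) × (Fin c → Fin 3) → ℝ := fun p =>
  ∑ s : Fin (constituentTriples c).card,
    if ((constituentTriples c).equivFin.symm s).1.2.2 = (p.1 : ℕ) then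
      ((termFibre (tripleTermMap h) s).card : ℝ) / n * γZ ((constituentTriples c).equivFin.symm s).1 p.2
    else 0

/-- **`λ_Z` at the type**: `∑_S (|S|/n) H(γ_S)` over the coarse classes `S` of Def. 5.15 (`γ_S = γ_{Z,i,j,k}`
on a boundary class, `γ̄_{Z,+,+,k}` on `S_{+,+,k}`; `|S|/n = α(i,j,k)`, resp. `α(+,+,k)`), i.e. the printed
`λ_Z = ∑_{i=0 ∨ j=0} α(i,j,k) H(γ_{Z,i,j,k}) + ∑_k α(+,+,k) H(γ̄_{Z,+,+,k})`. [cite: VassilevskaWilliamsXuXuZhou2024, §5 (preamble: λ_Z)] -/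
def targetLambda {I J K : Fin n → ℕ} (h : IsLevelTriple c I J K) (α : ℕ × ℕ × ℕ → ℝ)
    (γZ : ℕ × ℕ × ℕ → (Fin c → Fin 3) → ℝ) : ℝ :=
  ∑ s : Fin (coarseClasses c).card,
    ((termFibre (coarseTermMap h) s).card : ℝ) / n * shannonEntropy (coarseTermList c α γZ s).γX

/-- **The `o_{1/ε}(1)` of Thm. 5.3 (one region), explicit**: `(|A_pair| + 3^c) · m(ε)`,
`m(ε) = (−ε log ε + ε)/log 2`. [cite: VassilevskaWilliamsXuXuZhou2024, Thm. 5.3 ("− o_{1/ε}(1)")] -/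
def epsLoss (c : ℕ) (ε : ℝ) : ℝ :=
  (Fintype.card (Fin (2 * c + 1) × (Fin c → Fin 3)) + Fintype.card (Fin c → Fin 3)) * entropyModulus ε

/-- `epsLoss ≥ 0` on `[0, 1]`. [folklore] -/
theorem epsLoss_nonneg (c : ℕ) {ε : ℝ} (h0 : 0 ≤ ε) (h1 : ε ≤ 1) : 0 ≤ epsLoss c ε :=
  mul_nonneg (by positivity) (entropyModulus_nonneg h0 h1)

/-- **`epsLoss → 0` as `ε → 0`.** [cite: VassilevskaWilliamsXuXuZhou2024, Thm. 5.3 (footnote: o_{1/ε}(1) → 0 as ε → 0)] -/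
theorem tendsto_epsLoss (c : ℕ) : Filter.Tendsto (epsLoss c) (nhds 0) (nhds 0) := by
  have := tendsto_entropyModulus.const_mul
    ((Fintype.card (Fin (2 * c + 1) × (Fin c → Fin 3)) : ℝ) + Fintype.card (Fin c → Fin 3))
  rw [mul_zero] at this
  exact this

/-- The chunks are partitioned by the terms: `∑_t n_t = n`. [folklore] -/
theorem sum_card_termFibre {s : ℕ} (τ : Fin n → Fin s) : ∑ t, (termFibre τ t).card = n := by
  have := card_eq_sum_card_fiberwise (f := τ) (s := (univ : Finset (Fin n))) (t := univ) fun _ _ => mem_univ _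
  rw [card_univ, Fintype.card_fin] at this
  exact this.symm

/-- `(∑_t n_t)/n ≤ 1` (with equality for `n ≥ 1`). [folklore] -/
theorem sum_card_termFibre_div_le {s : ℕ} (τ : Fin n → Fin s) : ∑ t, ((termFibre τ t).card : ℝ) / n ≤ 1 := by
  rw [← sum_div]
  have : (∑ t, ((termFibre τ t).card : ℝ)) = n := by exact_mod_cast sum_card_termFibre τ
  rw [this]
  rcases Nat.eq_zero_or_pos n with h0 | hpos
  · subst h0; simp
  · rw [div_self (by exact_mod_cast hpos.ne')]

/-- `0 ≤ θ̄ ≤ 1` pointwise when `0 ≤ γ_Z ≤ 1`. [folklore] -/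
theorem targetPairDist_mem_Icc {I J K : Fin n → ℕ} (h : IsLevelTriple c I J K) {γZ : ℕ × ℕ × ℕ → (Fin c → Fin 3) → ℝ}
    (hγ0 : ∀ ijk σ, 0 ≤ γZ ijk σ) (hγ1 : ∀ ijk σ, γZ ijk σ ≤ 1) (p : Fin (2 * c + 1) × (Fin c → Fin 3)) :
    0 ≤ targetPairDist h γZ p ∧ targetPairDist h γZ p ≤ 1 := by
  unfold targetPairDist
  refine ⟨sum_nonneg fun s _ => ?_, ?_⟩
  · split_ifs
    · exact mul_nonneg (by positivity) (hγ0 _ _)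
    · exact le_rfl
  · refine (sum_le_sum (g := fun s => ((termFibre (tripleTermMap h) s).card : ℝ) / n) fun s _ => ?_).trans
      (sum_card_termFibre_div_le _)
    split_ifs
    · have := hγ1 ((constituentTriples c).equivFin.symm s).1 p.2
      have h0 : (0 : ℝ) ≤ ((termFibre (tripleTermMap h) s).card : ℝ) / n := by positivity
      nlinarith
    · positivity

/-- **The joint type of `(K₀, K̂)` over `n`, term by term**: `θ(k', σ)/n = ∑_{t : k_t = k'} (n_t/n) split(K̂, term t)(σ)`.
[cite: VassilevskaWilliamsXuXuZhou2024, Claim 5.14 (proof, (2))] -/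
theorem letterCount_pairSeq_div_eq_sum (T : (Fin n → Fin (2 * c + 1)) × (Fin n → Fin (2 * c + 1)) × (Fin n → Fin (2 * c + 1)))
    (h : IsLevelTriple c (seqVal T.1) (seqVal T.2.1) (seqVal T.2.2)) (Kh : Fin n → Fin c → Fin 3)
    (p : Fin (2 * c + 1) × (Fin c → Fin 3)) :
    ((letterCount (GlobalStageData.pairSeq T.2.2 Kh) p : ℕ) : ℝ) / n =
      ∑ s : Fin (constituentTriples c).card,
        if ((constituentTriples c).equivFin.symm s).1.2.2 = (p.1 : ℕ) then
          ((termFibre (tripleTermMap h) s).card : ℝ) / n * completeSplitOn Kh (termFibre (tripleTermMap h) s) p.2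
        else 0 := by
  classical
  have hterm : ∀ s : Fin (constituentTriples c).card,
      ((termFibre (tripleTermMap h) s).card : ℝ) / n * completeSplitOn Kh (termFibre (tripleTermMap h) s) p.2 =
        (((termFibre (tripleTermMap h) s).filter fun t => Kh t = p.2).card : ℝ) / n := by
    intro s
    rw [div_mul_eq_mul_div, mul_comm, completeSplitOn_mul_card]
  simp_rw [hterm]
  rw [letterCount_apply, card_eq_sum_card_fiberwise (f := tripleTermMap h)
    (s := univ.filter fun m => GlobalStageData.pairSeq T.2.2 Kh m = p) (t := univ) (fun _ _ => mem_univ _)]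
  push_cast
  rw [sum_div]
  refine sum_congr rfl fun s _ => ?_
  -- the level of the positions of the fibre of `s`
  have hfib : ∀ t, tripleTermMap h t = s → (T.2.2 t : ℕ) = ((constituentTriples c).equivFin.symm s).1.2.2 := by
    intro t ht
    have ht' : t ∈ univ.filter fun t => tripleTermMap h t = s := by simp [ht]
    rw [filter_tripleTermMap_eq h s, mem_posClass] at ht'
    exact ht'.2.2
  split_ifs with hk
  · have hXY : ((univ.filter fun m => GlobalStageData.pairSeq T.2.2 Kh m = p).filter fun t => tripleTermMap h t = s) =
        (termFibre (tripleTermMap h) s).filter fun t => Kh t = p.2 := by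
      ext t
      simp only [mem_filter, mem_univ, true_and, GlobalStageData.pairSeq, Prod.ext_iff, termFibre]
      constructor
      · rintro ⟨⟨-, h2⟩, h3⟩; exact ⟨h3, h2⟩
      · rintro ⟨h3, h2⟩
        refine ⟨⟨Fin.ext ?_, h2⟩, h3⟩
        rw [hfib t h3, hk]
    rw [hXY]
  · rw [div_eq_zero_iff]
    left
    norm_cast
    rw [card_eq_zero, filter_eq_empty_iff]
    intro t ht hts
    rw [mem_filter] at ht
    obtain ⟨-, hpt⟩ := ht
    apply hk
    rw [← hfib t hts, ← hpt]
    rfl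

/-- **The realised `θ/n` is within `ε` of `θ̄`** for an `ε`-admissible `Z`-sequence. [cite: VassilevskaWilliamsXuXuZhou2024, Thm. 5.3 (proof: "the L_∞ distance … is at most ε")] -/
theorem abs_pairDist_sub_targetPairDist_le (T : (Fin n → Fin (2 * c + 1)) × (Fin n → Fin (2 * c + 1)) × (Fin n → Fin (2 * c + 1)))
    (h : IsLevelTriple c (seqVal T.1) (seqVal T.2.1) (seqVal T.2.2)) {γX γY γZ : ℕ × ℕ × ℕ → (Fin c → Fin 3) → ℝ}
    {ε : ℝ} (hε : 0 ≤ ε) {Kh : Fin n → Fin c → Fin 3}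
    (hK : Kh ∈ levelBlocksZ (tripleTermMap h) (tripleTermList c γX γY γZ) ε) (p : Fin (2 * c + 1) × (Fin c → Fin 3)) :
    |((letterCount (GlobalStageData.pairSeq T.2.2 Kh) p : ℕ) : ℝ) / n - targetPairDist h γZ p| ≤ ε := by
  rw [letterCount_pairSeq_div_eq_sum T h Kh p]
  simp only [targetPairDist]
  rw [← sum_sub_distrib]
  refine (abs_sum_le_sum_abs _ _).trans ?_
  calc _ ≤ ∑ s, ((termFibre (tripleTermMap h) s).card : ℝ) / n * ε := by
        refine sum_le_sum fun s _ => ?_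
        have hw : (0 : ℝ) ≤ ((termFibre (tripleTermMap h) s).card : ℝ) / n := by positivity
        split_ifs with hk
        · rw [← mul_sub, abs_mul, abs_of_nonneg hw]
          rcases (termFibre (tripleTermMap h) s).eq_empty_or_nonempty with h0 | hne
          · rw [h0, card_empty, Nat.cast_zero, zero_div, zero_mul, zero_mul]
          · refine mul_le_mul_of_nonneg_left ?_ hw
            have := (mem_admissibleSeqs.1 hK).2 s hne p.2
            simpa [tripleTermList] using this
        · rw [sub_zero, abs_zero]; exact mul_nonneg hw hε
    _ = (∑ s, ((termFibre (tripleTermMap h) s).card : ℝ) / n) * ε := by rw [sum_mul]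
    _ ≤ 1 * ε := mul_le_mul_of_nonneg_right (sum_card_termFibre_div_le _) hε
    _ = ε := one_mul ε

/-- **`H(θ/n) ≥ H(γ̄_Z) − |A_pair| m(ε)`** for the realised `Z`-block (continuity of `H`).
[cite: VassilevskaWilliamsXuXuZhou2024, Thm. 5.3 (proof, continuity step)] -/
theorem shannonEntropy_targetPairDist_sub_le (T : (Fin n → Fin (2 * c + 1)) × (Fin n → Fin (2 * c + 1)) × (Fin n → Fin (2 * c + 1)))
    (h : IsLevelTriple c (seqVal T.1) (seqVal T.2.1) (seqVal T.2.2)) {γX γY γZ : ℕ × ℕ × ℕ → (Fin c → Fin 3) → ℝ}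
    (hγ0 : ∀ ijk σ, 0 ≤ γZ ijk σ) (hγ1 : ∀ ijk σ, γZ ijk σ ≤ 1) {ε : ℝ} (hε0 : 0 ≤ ε) (hε1 : ε ≤ 1)
    {Kh : Fin n → Fin c → Fin 3} (hK : Kh ∈ levelBlocksZ (tripleTermMap h) (tripleTermList c γX γY γZ) ε) :
    shannonEntropy (targetPairDist h γZ) - Fintype.card (Fin (2 * c + 1) × (Fin c → Fin 3)) * entropyModulus ε ≤
      shannonEntropy (fun p => ((letterCount (GlobalStageData.pairSeq T.2.2 Kh) p : ℕ) : ℝ) / n) := by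
  refine le_shannonEntropy_add_of_abs_sub_le (fun p => by positivity) (fun p => ?_)
    (fun p => (targetPairDist_mem_Icc h hγ0 hγ1 p).1) (fun p => (targetPairDist_mem_Icc h hγ0 hγ1 p).2) hε1
    (fun p => abs_pairDist_sub_targetPairDist_le T h hε0 hK p)
  -- `letterCount ≤ n`
  rcases Nat.eq_zero_or_pos n with h0 | hpos
  · subst h0; simp
  · rw [div_le_one (by exact_mod_cast hpos)]
    have := sum_letterCount (GlobalStageData.pairSeq T.2.2 Kh)
    have hle : letterCount (GlobalStageData.pairSeq T.2.2 Kh) p ≤ n :=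
      (single_le_sum (f := letterCount (GlobalStageData.pairSeq T.2.2 Kh)) (fun _ _ => Nat.zero_le _)
        (mem_univ p)).trans_eq this
    exact_mod_cast hle

/-- **`Λ/n ≤ λ_Z + 3^c m(ε)`** for the class types of the realised `Z`-block (`ε`-admissible for the
coarse datum, then continuity of `H` class by class, weights `|S|/n`). [cite: VassilevskaWilliamsXuXuZhou2024, Thm. 5.3 (proof, continuity step)] -/
theorem realisedLambda_le_targetLambda_add {α : ℕ × ℕ × ℕ → ℝ} {γX γY γZ : ℕ × ℕ × ℕ → (Fin c → Fin 3) → ℝ}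
    {I J K : Fin n → ℕ} (h : IsLevelTriple c I J K) (hα : IsAlphaConsistent α I J K) (hα0 : ∀ ijk, 0 ≤ α ijk)
    (hγ0 : ∀ ijk σ, 0 ≤ γZ ijk σ) (hγ1 : ∀ ijk σ, γZ ijk σ ≤ 1) {ε : ℝ} (hε0 : 0 ≤ ε) (hε1 : ε ≤ 1)
    {Kh : Fin n → Fin c → Fin 3} (hK : Kh ∈ levelBlocksZ (tripleTermMap h) (tripleTermList c γX γY γZ) ε) :
    (∑ s, ((termFibre (coarseTermMap h) s).card : ℝ) *
        shannonEntropy (fun σ => (coarseProfile h Kh s σ : ℝ) / (termFibre (coarseTermMap h) s).card)) / n ≤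
      targetLambda h α γZ + Fintype.card (Fin c → Fin 3) * entropyModulus ε := by
  have hadm := mem_levelBlocksX_coarse_of_mem_levelBlocksZ h hα hK
  -- the realised term as `(|S|/n) H(split(K̂, S))`
  have hreal : (∑ s, ((termFibre (coarseTermMap h) s).card : ℝ) *
      shannonEntropy (fun σ => (coarseProfile h Kh s σ : ℝ) / (termFibre (coarseTermMap h) s).card)) / n =
      ∑ s, ((termFibre (coarseTermMap h) s).card : ℝ) / n * shannonEntropy (completeSplitOn Kh (termFibre (coarseTermMap h) s)) := by
    rw [sum_div]
    refine sum_congr rfl fun s _ => ?_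
    rw [mul_div_right_comm]
    rfl
  rw [hreal, targetLambda]
  -- restrict both sums to the non-empty classes
  set NE := (univ : Finset (Fin (coarseClasses c).card)).filter fun s => (termFibre (coarseTermMap h) s).Nonempty with hNE
  have hrestrict : ∀ (f : Fin (coarseClasses c).card → ℝ),
      ∑ s, ((termFibre (coarseTermMap h) s).card : ℝ) / n * f s = ∑ s ∈ NE, ((termFibre (coarseTermMap h) s).card : ℝ) / n * f s := by
    intro f
    rw [hNE, sum_filter_of_ne]
    intro s _ hne
    by_contra hempty
    rw [not_nonempty_iff_eq_empty] at hempty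
    rw [hempty, card_empty, Nat.cast_zero, zero_div, zero_mul] at hne
    exact hne rfl
  rw [hrestrict (fun s => shannonEntropy (completeSplitOn Kh (termFibre (coarseTermMap h) s))),
    hrestrict (fun s => shannonEntropy (coarseTermList c α γZ s).γX)]
  have hw : ∀ s ∈ NE, (0 : ℝ) ≤ ((termFibre (coarseTermMap h) s).card : ℝ) / n := fun s _ => by positivity
  have hw1 : ∑ s ∈ NE, ((termFibre (coarseTermMap h) s).card : ℝ) / n ≤ 1 :=
    (sum_le_sum_of_subset_of_nonneg (filter_subset _ _) fun s _ _ => by positivity).trans (sum_card_termFibre_div_le _)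
  have hQ : ∀ s σ, 0 ≤ (coarseTermList c α γZ s).γX σ ∧ (coarseTermList c α γZ s).γX σ ≤ 1 := fun s σ =>
    coarseGamma_mem_Icc hα0 hγ0 hγ1 _ σ
  have hclose : ∀ s ∈ NE, ∀ σ, |completeSplitOn Kh (termFibre (coarseTermMap h) s) σ - (coarseTermList c α γZ s).γX σ| ≤ ε := by
    intro s hs σ
    have hne : (termFibre (coarseTermMap h) s).Nonempty := (mem_filter.1 hs).2
    exact (mem_admissibleSeqs.1 hadm).2 s hne σ
  have habs := abs_sum_mul_shannonEntropy_sub_le NE hw hw1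
    (P := fun s => completeSplitOn Kh (termFibre (coarseTermMap h) s)) (Q := fun s => (coarseTermList c α γZ s).γX)
    (fun s _ σ => completeSplitOn_nonneg _ _ σ) (fun s _ σ => completeSplitOn_le_one _ _ σ)
    (fun s _ σ => (hQ s σ).1) (fun s _ σ => (hQ s σ).2) hε0 hε1 hclose
  rw [abs_le] at habs
  linarith [habs.2]

end Target

/-! ## Theorem 5.3, one region -/

section Thm53

variable (R : Type u) [CommSemiring R] (q : ℕ) {c n : ℕ}
variable {Q : Fin (2 * c + 1) × Fin (2 * c + 1) × Fin (2 * c + 1) → ℕ}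
variable {T₀ : (Fin n → Fin (2 * c + 1)) × (Fin n → Fin (2 * c + 1)) × (Fin n → Fin (2 * c + 1))}

/-- Arithmetic of the exponent: replacing the third branch of the minimum by a smaller quantity up to
`e ≥ 0` costs at most `e`. [folklore] -/
theorem min_branch_sub_le {A B Ct Cr D e m Err L : ℝ} (hm : 0 ≤ m) (he : Ct - e ≤ Cr) (he0 : 0 ≤ e)
    (hL : m * min (min A B) (min Cr D) - Err ≤ L) : m * (min (min A B) (min Ct D) - e) - Err ≤ L := by
  refine le_trans ?_ hL
  have hmin : min (min A B) (min Ct D) - e ≤ min (min A B) (min Cr D) := by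
    refine le_min (le_min ?_ ?_) (le_min ?_ ?_)
    · linarith [min_le_left (min A B) (min Ct D), min_le_left A B]
    · linarith [min_le_left (min A B) (min Ct D), min_le_right A B]
    · linarith [min_le_right (min A B) (min Ct D), min_le_left Ct D]
    · linarith [min_le_right (min A B) (min Ct D), min_le_right Ct D]
  linarith [mul_le_mul_of_nonneg_left hmin hm]

/-- **Vassilevska Williams–Xu–Xu–Zhou, Theorem 5.3 — one region, at fixed `n`, with explicit errors.**
For a joint type `Q` of level-`ℓ` block triples (`∑ Q = n`, supported on `i+j+k = 2c`), a triple `T₀` of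
type `Q` (whose term map `τ₀` realises the parameter list `{(n α(i,j,k), i, j, k, γ_{X,i,j,k}, γ_{Y,i,j,k},
γ_{Z,i,j,k})}`, `α = Q/n`), target split distributions `γ` with `0 ≤ γ_Z ≤ 1` and `0 ≤ ε ≤ 1`:
`((n+1)^{3^c |S₃|})^3 = 2^{o(n)}` independent copies of `(CW_q^{⊗c})^{⊗n}` restrict to (hence degenerate
to) `κ` independent copies of the level-`ℓ` `ε`-interface tensor `𝒯_{τ₀, L(γ), ε}`, where
`log₂(κ+1) ≥ n · (E₁ − epsLoss c ε) − thm53Err c n`,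
`E₁ = min{H(Q_X/n) − P, H(Q_Y/n) − P, H(θ̄) − λ_Z, H(Q/n)}` (`P = maxEnt(Q/n) − H(Q/n)` the penalty
`P_α` at the type, `H(θ̄) = H(γ̄_Z)`, `λ_Z` = `targetLambda`, the last branch dominated by the first),
`epsLoss → 0` as `ε → 0` and `thm53Err = o(n)` (`O(√n)` Behrend loss plus the `O(n/log n)` batch
size of Cor. 4.2; `GlobalStageAsymptotic.lean`) — the printed
`2^{(A₁E₁ − o_{1/ε}(1)) n − o(n)}` for the first region (`A₁ n ↦ n`).  Proof as printed: one copy of the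
input per realised cell (family of integral split distributions within `ε` of `γ`), Prop. 5.1 for the
cell (`vxxz2024_thm53_cell`), continuity of the exponent, and the merge of the cells into the
`ε`-interface tensor (`vxxz2024_thm53_merge`). [cite: VassilevskaWilliamsXuXuZhou2024, Thm. 5.3] -/
theorem vxxz2024_thm53_region (hc : 0 < c) (hn : 0 < n) (hQ : ∑ s, Q s = n)
    (hQs : ∀ s, s ∉ levelSupport (2 * c) → Q s = 0) (hT₀ : T₀ ∈ jointTypeClass n Q)
    (γX γY γZ : ℕ × ℕ × ℕ → (Fin c → Fin 3) → ℝ) (hγ0 : ∀ ijk σ, 0 ≤ γZ ijk σ) (hγ1 : ∀ ijk σ, γZ ijk σ ≤ 1)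
    {ε : ℝ} (hε0 : 0 ≤ ε) (hε1 : ε ≤ 1) :
    ∃ κ : ℕ,
      TensorRestrictsTo
        (kroneckerTensor (unitTensor R (((n + 1) ^ (3 ^ c * (constituentTriples c).card)) ^ 3))
          (kroneckerPow (kroneckerPow (bigCwTensor R q) c) n))
        (kroneckerTensor (unitTensor R κ)
          (interfaceTensor R q (tripleTermMap (isLevelTriple_of_mem_jointTypeClass hQs hT₀)) (tripleTermList c γX γY γZ) ε)) ∧
      (n : ℝ) * (min (min (shannonEntropy (fun i => ((∑ j, ∑ l, Q (i, j, l) : ℕ) : ℝ) / n) -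
              (maxEntropyGivenMarginals (levelSupport (2 * c)) (fun s => (Q s : ℝ) / n) - shannonEntropy (fun s => (Q s : ℝ) / n)))
            (shannonEntropy (fun j => ((∑ i, ∑ l, Q (i, j, l) : ℕ) : ℝ) / n) -
              (maxEntropyGivenMarginals (levelSupport (2 * c)) (fun s => (Q s : ℝ) / n) - shannonEntropy (fun s => (Q s : ℝ) / n))))
          (min (shannonEntropy (targetPairDist (isLevelTriple_of_mem_jointTypeClass hQs hT₀) γZ) -
              targetLambda (isLevelTriple_of_mem_jointTypeClass hQs hT₀) (typeAlpha n Q) γZ)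
            (shannonEntropy (fun s => (Q s : ℝ) / n))) - epsLoss c ε) - thm53Err c n ≤
        Real.logb 2 ((κ : ℝ) + 1) := by
  classical
  set τ₀ := tripleTermMap (isLevelTriple_of_mem_jointTypeClass hQs hT₀) with hτ₀
  set L := tripleTermList c γX γY γZ with hL
  -- the uniform number of copies
  set bound : ℝ := (n : ℝ) * (min (min (shannonEntropy (fun i => ((∑ j, ∑ l, Q (i, j, l) : ℕ) : ℝ) / n) -
              (maxEntropyGivenMarginals (levelSupport (2 * c)) (fun s => (Q s : ℝ) / n) - shannonEntropy (fun s => (Q s : ℝ) / n)))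
            (shannonEntropy (fun j => ((∑ i, ∑ l, Q (i, j, l) : ℕ) : ℝ) / n) -
              (maxEntropyGivenMarginals (levelSupport (2 * c)) (fun s => (Q s : ℝ) / n) - shannonEntropy (fun s => (Q s : ℝ) / n))))
          (min (shannonEntropy (targetPairDist (isLevelTriple_of_mem_jointTypeClass hQs hT₀) γZ) -
              targetLambda (isLevelTriple_of_mem_jointTypeClass hQs hT₀) (typeAlpha n Q) γZ)
            (shannonEntropy (fun s => (Q s : ℝ) / n))) - epsLoss c ε) - thm53Err c n with hbound
  have h2pos : 0 < (2 : ℝ) ^ bound := Real.rpow_pos_of_pos two_pos _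
  have hceil : 1 ≤ ⌈(2 : ℝ) ^ bound⌉₊ := Nat.one_le_iff_ne_zero.2 fun h0 => (not_le.2 h2pos) (Nat.ceil_eq_zero.1 h0)
  refine ⟨⌈(2 : ℝ) ^ bound⌉₊ - 1, ?_, ?_⟩
  swap
  · -- `bound ≤ log₂ ⌈2^bound⌉`
    have hκ1 : (((⌈(2 : ℝ) ^ bound⌉₊ - 1 : ℕ) : ℝ) + 1) = ⌈(2 : ℝ) ^ bound⌉₊ := by
      rw [Nat.cast_sub hceil]; push_cast; ring
    rw [hκ1]
    calc bound = Real.logb 2 ((2 : ℝ) ^ bound) := (Real.logb_rpow two_pos (by norm_num)).symm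
      _ ≤ Real.logb 2 (⌈(2 : ℝ) ^ bound⌉₊ : ℝ) := Real.logb_le_logb_of_le one_lt_two h2pos (Nat.le_ceil _)
  · -- every realised cell carries at least `⌈2^bound⌉ − 1` copies of its exact interface tensor
    have hα0 : ∀ ijk, 0 ≤ typeAlpha n Q ijk := by
      intro ijk; unfold typeAlpha; split_ifs <;> positivity
    have hcell : ∀ j : ↥(realisedCells R q τ₀ L ε),
        TensorRestrictsTo (kroneckerPow (kroneckerPow (bigCwTensor R q) c) n)
          (kroneckerTensor (unitTensor R (⌈(2 : ℝ) ^ bound⌉₊ - 1)) (interfaceTensor R q τ₀ (cellTermList τ₀ L j.1) 0)) := by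
      rintro ⟨abc, habc⟩
      have hmem := habc
      unfold realisedCells at hmem
      rw [mem_filter] at hmem
      obtain ⟨-, x, y, z, hne, rfl⟩ := hmem
      obtain ⟨κj, hres, hbj⟩ := vxxz2024_thm53_cell R q hc hn hQ hQs hT₀ hne
      have hzm := (interfaceTensor_ne_zero R q hne).2.2
      have hθ := shannonEntropy_targetPairDist_sub_le T₀ (isLevelTriple_of_mem_jointTypeClass hQs hT₀) hγ0 hγ1 hε0 hε1 hzm
      have hΛ := realisedLambda_le_targetLambda_add (isLevelTriple_of_mem_jointTypeClass hQs hT₀)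
        (isAlphaConsistent_typeAlpha hT₀) hα0 hγ0 hγ1 hε0 hε1 hzm
      have hbound_le : bound ≤ Real.logb 2 ((κj : ℝ) + 1) := by
        rw [hbound]
        refine min_branch_sub_le (Nat.cast_nonneg n) ?_ (epsLoss_nonneg c hε0 hε1) hbj
        unfold epsLoss
        linarith
      have hκle : ⌈(2 : ℝ) ^ bound⌉₊ - 1 ≤ κj := by
        have h1 : (2 : ℝ) ^ bound ≤ (κj : ℝ) + 1 := (Real.le_logb_iff_rpow_le one_lt_two (by positivity)).1 hbound_le
        have h2 : ⌈(2 : ℝ) ^ bound⌉₊ ≤ κj + 1 := Nat.ceil_le.2 (by exact_mod_cast h1)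
        omega
      exact hres.trans (TensorRestrictsTo.kronecker (tensorRestrictsTo_unitTensor_castLE hκle) (TensorRestrictsTo.refl _))
    -- assemble: copies of the input ≥ ⊕_{cells} input ≥ ⊕_{cells} ⟨κ⟩ ⊗ 𝒯_cell ≥ ⟨κ⟩ ⊗ ⊕ 𝒯_cell ≥ ⟨κ⟩ ⊗ 𝒯_ε
    have hJ : Fintype.card ↥(realisedCells R q τ₀ L ε) ≤ ((n + 1) ^ (3 ^ c * (constituentTriples c).card)) ^ 3 := by
      rw [Fintype.card_coe]; exact card_realisedCells_le R q τ₀ L ε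
    refine (kronecker_unit_le_familyDirectSum_const hJ _).trans ?_
    refine (familyDirectSum_mono hcell).trans ?_
    refine (familyDirectSum_kronecker_unit_le (⌈(2 : ℝ) ^ bound⌉₊ - 1) _).trans ?_
    exact TensorRestrictsTo.kronecker (TensorRestrictsTo.refl _) (vxxz2024_thm53_merge R q τ₀ L ε)

end Thm53


end Literature.Computability.AlgebraicComplexity
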